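import Mathlib
import Summits.Ventures.PercRepro2.Defs
import Summits.Ventures.PercRepro2.Harris
import Summits.Ventures.PercRepro2.Graph
import Summits.Ventures.PercRepro2.Events
import Summits.Ventures.PercRepro2.TReduction
import Summits.Ventures.PercRepro2.TMonoH

/-!
# (T) from the antipodal couplings on the star of `h` alone (blind cell PercRepro2, mine-a g44)

`TReduction.tform_nonneg_of_base` derives the three-event inequality (T) for every admissible
weight vector from the *antipodal base cases* `K_D(a) ≥ 0` — every edge pinned or antipodal, the
purely combinatorial 2-colouring sums of the minors.  This file weakens the hypothesis: only the
edges leaving the *class of `h`* (the vertices joined to `h` by the edges pinned open by the weight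
vector off `D`) need to be antipodal; every other edge keeps an arbitrary admissible weight.

  (STAR)  `0 ≤ kform Q U e D p` whenever `D` touches the class of `h` and every boundary edge of
          the class not in `D` is pinned closed (`p x = 0`).

`kform_nonneg_of_star` proves `0 ≤ kform Q U e D p` for every admissible `p` and every `D`
touching the class of `h` from (STAR), by the pinning identity `kform_pin` applied to the free
boundary edges of the class: pinning such an edge closed keeps the class and removes a free edge,
pinning it open enlarges the class (one edge more is pinned open), moving it into `D` removes it
from the edges off `D` — the measure `starMeasure` (the number of edges off `D` not pinned open,
weighted by `|E| + 1`, plus the number of free edges) decreases in each case.  When no boundary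
edge of the class is free, every boundary edge off `D` is closed (a boundary edge off `D` cannot be
pinned open: its outer endpoint would lie in the class, `ne_one_of_mem_boundary`), which is the
(STAR) hypothesis.  `tform_nonneg_of_star` states (T) for arbitrary events, `t_cluster_of_star`
the cell's cluster form.  Nothing here uses monotonicity of the events: the reduction is the
algebra of `kform_pin` together with the bookkeeping of the class of `h`.  For the cluster events
of MINE-A.md §99.3, (STAR) is implied by the Bernstein positivity of `TReduction` (the antipodal
expansion of the non-star edges), so it has the same exact-census standing, and it is pointwise in
every weight off the star.  No instance, no notation.
-/

namespace Summit.Ventures.PercRepro2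

namespace TReduction

open Finset

section Star

variable {E : Type*} [Fintype E] [DecidableEq E] {R : Type*} [Field R] [LinearOrder R]
  [IsStrictOrderedRing R] {V : Type*}

omit [Fintype E] [IsStrictOrderedRing R] in
/-- The class of `h` under `(D, p)`: the cluster of `h` in the edges pinned open by `p` off `D`. -/
def hClass (ends : E → Sym2 V) (p : E → R) (D : Finset E) (h : V) : Set V :=
  cluster ends (pinnedOpenConfig p D) h

omit [IsStrictOrderedRing R] in
/-- The measure of the star induction: the number of edges off `D` that are not pinned open,
weighted by `|E| + 1`, plus the number of free edges. -/
def starMeasure (D : Finset E) (p : E → R) : ℕ :=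
  ((univ \ D).filter fun x => p x ≠ 1).card * (Fintype.card E + 1) + (freeEdges D p).card

omit [Fintype E] [IsStrictOrderedRing R] in
/-- Pinning an edge that is not pinned open to `0` does not change the pinned-open edges. -/
lemma pinnedOpenConfig_update_zero (p : E → R) (D : Finset E) {g : E} (hg : p g ≠ 1) :
    pinnedOpenConfig (Function.update p g 0) D = pinnedOpenConfig p D := by
  funext x
  by_cases hx : x = g
  · subst hx
    simp [pinnedOpenConfig, hg]
  · simp [pinnedOpenConfig, Function.update_of_ne hx]

omit [Fintype E] [IsStrictOrderedRing R] in
/-- Moving an edge that is not pinned open into `D` does not change the pinned-open edges. -/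
lemma pinnedOpenConfig_insert (p : E → R) (D : Finset E) {g : E} (hg : p g ≠ 1) :
    pinnedOpenConfig p (insert g D) = pinnedOpenConfig p D := by
  funext x
  by_cases hx : x = g
  · subst hx
    simp [pinnedOpenConfig, hg]
  · simp [pinnedOpenConfig, hx]

omit [Fintype E] [IsStrictOrderedRing R] in
/-- Pinning an edge open can only add pinned-open edges. -/
lemma pinnedOpenConfig_le_update_one (p : E → R) (D : Finset E) (g : E) :
    pinnedOpenConfig p D ≤ pinnedOpenConfig (Function.update p g 1) D := by
  intro x
  rw [Bool.le_iff_imp]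
  intro hx1
  simp only [pinnedOpenConfig, decide_eq_true_eq] at hx1 ⊢
  obtain ⟨hxD, hx1⟩ := hx1
  refine ⟨hxD, ?_⟩
  by_cases hxg : x = g
  · rw [hxg]
    simp
  · rw [Function.update_of_ne hxg]
    exact hx1

omit [Fintype E] [IsStrictOrderedRing R] in
/-- A boundary edge of the class of `h` that is not antipodal is not pinned open (its outer
endpoint would lie in the class). -/
lemma ne_one_of_mem_boundary (ends : E → Sym2 V) (p : E → R) (D : Finset E) (h : V) {x : E}
    (hx : x ∈ boundary ends (hClass ends p D h)) (hxD : x ∉ D) : p x ≠ 1 := by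
  intro h1
  obtain ⟨u, hu, v, hv, hends⟩ := hx
  apply hv
  by_cases huv : u = v
  · subst huv
    exact hu
  · have hadj : (openGraph ends (pinnedOpenConfig p D)).Adj u v := by
      rw [openGraph_adj]
      exact ⟨huv, x, by simp [pinnedOpenConfig, hxD, h1], hends⟩
    exact mem_cluster_of_adj hu hadj

omit [IsStrictOrderedRing R] in
/-- The edges not pinned open are unchanged by pinning a free edge closed. -/
lemma filter_ne_one_update_zero (D : Finset E) (p : E → R) {g : E} (hg : p g ≠ 1) :
    ((univ \ D).filter fun x => Function.update p g 0 x ≠ 1) =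
      (univ \ D).filter fun x => p x ≠ 1 := by
  ext x
  simp only [mem_filter, mem_sdiff, mem_univ, true_and]
  by_cases hx : x = g
  · subst hx
    simp [hg]
  · simp [Function.update_of_ne hx]

omit [IsStrictOrderedRing R] in
/-- Pinning an edge open removes it from the edges not pinned open. -/
lemma filter_ne_one_update_one (D : Finset E) (p : E → R) (g : E) :
    ((univ \ D).filter fun x => Function.update p g 1 x ≠ 1) =
      ((univ \ D).filter fun x => p x ≠ 1).erase g := by
  ext x
  simp only [mem_filter, mem_sdiff, mem_univ, true_and, mem_erase]
  by_cases hx : x = g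
  · subst hx
    simp
  · simp [hx]

omit [IsStrictOrderedRing R] in
/-- Moving an edge into `D` removes it from the edges off `D` not pinned open. -/
lemma filter_ne_one_insert (D : Finset E) (p : E → R) (g : E) :
    ((univ \ insert g D).filter fun x => p x ≠ 1) =
      ((univ \ D).filter fun x => p x ≠ 1).erase g := by
  ext x
  simp only [mem_filter, mem_sdiff, mem_univ, true_and, mem_erase, mem_insert, not_or]
  tauto

omit [IsStrictOrderedRing R] in
/-- Pinning a free edge closed decreases the measure. -/
lemma starMeasure_update_zero_lt (D : Finset E) (p : E → R) {g : E} (hg : g ∈ freeEdges D p) :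
    starMeasure D (Function.update p g 0) < starMeasure D p := by
  have hg1 : p g ≠ 1 := (mem_freeEdges.1 hg).2.2
  unfold starMeasure
  rw [filter_ne_one_update_zero D p hg1, freeEdges_update D p hg (Or.inl rfl),
    card_erase_of_mem hg]
  have h2 : 0 < (freeEdges D p).card := card_pos.2 ⟨g, hg⟩
  omega

omit [IsStrictOrderedRing R] in
/-- Pinning a free edge open decreases the measure. -/
lemma starMeasure_update_one_lt (D : Finset E) (p : E → R) {g : E} (hg : g ∈ freeEdges D p) :
    starMeasure D (Function.update p g 1) < starMeasure D p := by
  obtain ⟨hgD, -, hg1⟩ := mem_freeEdges.1 hg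
  have hmem : g ∈ (univ \ D).filter fun x => p x ≠ 1 := by simp [hgD, hg1]
  unfold starMeasure
  rw [filter_ne_one_update_one D p g, freeEdges_update D p hg (Or.inr rfl),
    card_erase_of_mem hmem, card_erase_of_mem hg, Nat.sub_one_mul]
  have h1 : 0 < ((univ \ D).filter fun x => p x ≠ 1).card := card_pos.2 ⟨g, hmem⟩
  have h2 : 0 < (freeEdges D p).card := card_pos.2 ⟨g, hg⟩
  have hAc : Fintype.card E + 1 ≤
      ((univ \ D).filter fun x => p x ≠ 1).card * (Fintype.card E + 1) :=
    Nat.le_mul_of_pos_left _ h1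
  omega

omit [IsStrictOrderedRing R] in
/-- Moving a free edge into `D` decreases the measure. -/
lemma starMeasure_insert_lt (D : Finset E) (p : E → R) {g : E} (hg : g ∈ freeEdges D p) :
    starMeasure (insert g D) p < starMeasure D p := by
  obtain ⟨hgD, -, hg1⟩ := mem_freeEdges.1 hg
  have hmem : g ∈ (univ \ D).filter fun x => p x ≠ 1 := by simp [hgD, hg1]
  unfold starMeasure
  rw [filter_ne_one_insert D p g, freeEdges_insert D p g, card_erase_of_mem hmem,
    card_erase_of_mem hg, Nat.sub_one_mul]
  have h1 : 0 < ((univ \ D).filter fun x => p x ≠ 1).card := card_pos.2 ⟨g, hmem⟩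
  have h2 : 0 < (freeEdges D p).card := card_pos.2 ⟨g, hg⟩
  have hAc : Fintype.card E + 1 ≤
      ((univ \ D).filter fun x => p x ≠ 1).card * (Fintype.card E + 1) :=
    Nat.le_mul_of_pos_left _ h1
  omega

/-- **The star reduction.** If every antipodal sum is nonnegative once the antipodal set `D` touches
the class of `h` and every other boundary edge of the class is pinned closed — (STAR) — then
`K_D(p) ≥ 0` for every admissible `p` and every `D` touching the class of `h`. -/
theorem kform_nonneg_of_star (ends : E → Sym2 V) (h : V) (Q U e : Set (Config E))
    (hstar : ∀ (D : Finset E) (p : E → R), IsProbVec p →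
      (∀ x ∈ D, x ∈ touches ends (hClass ends p D h)) →
      (∀ x, x ∉ D → x ∈ boundary ends (hClass ends p D h) → p x = 0) →
      0 ≤ kform Q U e D p) :
    ∀ (D : Finset E) (p : E → R), IsProbVec p →
      (∀ x ∈ D, x ∈ touches ends (hClass ends p D h)) → 0 ≤ kform Q U e D p := by
  suffices hn : ∀ n : ℕ, ∀ (D : Finset E) (p : E → R), IsProbVec p →
      (∀ x ∈ D, x ∈ touches ends (hClass ends p D h)) → starMeasure D p = n →
      0 ≤ kform Q U e D p from fun D p hp hD => hn _ D p hp hD rfl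
  intro n
  induction n using Nat.strong_induction_on with
  | _ n ih =>
    intro D p hp hD hn
    by_cases hfree : ∃ g, g ∉ D ∧ g ∈ boundary ends (hClass ends p D h) ∧ p g ≠ 0 ∧ p g ≠ 1
    · obtain ⟨g, hgD, hgb, hg0, hg1⟩ := hfree
      have hg : g ∈ freeEdges D p := mem_freeEdges.2 ⟨hgD, hg0, hg1⟩
      have h0 : 0 ≤ kform Q U e D (Function.update p g 0) := by
        refine ih _ ?_ D _ (hp.update g le_rfl zero_le_one) ?_ rfl
        · rw [← hn]
          exact starMeasure_update_zero_lt D p hg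
        · intro x hx
          show x ∈ touches ends (cluster ends (pinnedOpenConfig (Function.update p g 0) D) h)
          rw [pinnedOpenConfig_update_zero p D hg1]
          exact hD x hx
      have h1 : 0 ≤ kform Q U e D (Function.update p g 1) := by
        refine ih _ ?_ D _ (hp.update g zero_le_one le_rfl) ?_ rfl
        · rw [← hn]
          exact starMeasure_update_one_lt D p hg
        · intro x hx
          obtain ⟨u, hu, v, huv⟩ := hD x hx
          exact ⟨u, cluster_mono (pinnedOpenConfig_le_update_one p D g) h hu, v, huv⟩
      have h2 : 0 ≤ kform Q U e (insert g D) p := by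
        refine ih _ ?_ (insert g D) p hp ?_ rfl
        · rw [← hn]
          exact starMeasure_insert_lt D p hg
        · intro x hx
          show x ∈ touches ends (cluster ends (pinnedOpenConfig p (insert g D)) h)
          rw [pinnedOpenConfig_insert p D hg1]
          rcases mem_insert.1 hx with rfl | hx'
          · exact boundary_subset_touches ends _ hgb
          · exact hD x hx'
      rw [kform_pin Q U e hgD p]
      have hpg0 : 0 ≤ p g := hp.nonneg g
      have hpg1 : 0 ≤ 1 - p g := sub_nonneg.2 (hp.le_one g)
      exact add_nonneg (add_nonneg (mul_nonneg (sq_nonneg _) h0) (mul_nonneg (sq_nonneg _) h1))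
        (mul_nonneg (mul_nonneg hpg0 hpg1) h2)
    · apply hstar D p hp hD
      intro x hxD hxb
      by_contra hx0
      exact hfree ⟨x, hxD, hxb, hx0, ne_one_of_mem_boundary ends p D h hxb hxD⟩

/-- **(T) from (STAR)**: for admissible weights and ARBITRARY events `Q U e`,
`P(Q ∩ U) P(e) + P(Q ∩ e) P(U) ≤ P(Q ∩ U ∩ e) + P(Q) P(U ∩ e)` as soon as the antipodal sums over
the stars of the classes of `h` are nonnegative. -/
theorem tform_nonneg_of_star (ends : E → Sym2 V) (h : V) (Q U e : Set (Config E))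
    (hstar : ∀ (D : Finset E) (p : E → R), IsProbVec p →
      (∀ x ∈ D, x ∈ touches ends (hClass ends p D h)) →
      (∀ x, x ∉ D → x ∈ boundary ends (hClass ends p D h) → p x = 0) →
      0 ≤ kform Q U e D p) (p : E → R) (hp : IsProbVec p) :
    prob p (Q ∩ U) * prob p e + prob p (Q ∩ e) * prob p U ≤
      prob p (Q ∩ U ∩ e) + prob p Q * prob p (U ∩ e) := by
  have hk := kform_nonneg_of_star ends h Q U e hstar ∅ p hp
    (fun x hx => absurd hx (notMem_empty x))
  rw [kform_empty] at hk
  unfold gform at hk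
  linarith

/-- **(T_h) for the cluster events from (STAR)**: for admissible weights, a root `s`, a vertex
`h` and families `𝓤 𝓥` of vertex sets, (T_h) in the shape of `TFKG.t_of_isForest` follows from
(STAR) for the events `Q = {h ∈ C_s}`, `U = {C_s ∈ 𝓤}`, `e = {C_s ∈ 𝓥}`. -/
theorem t_cluster_of_star (p : E → R) (hp : IsProbVec p) (ends : E → Sym2 V) (s h : V)
    (𝓤 𝓥 : Set (Set V))
    (hstar : ∀ (D : Finset E) (a : E → R), IsProbVec a →
      (∀ x ∈ D, x ∈ touches ends (hClass ends a D h)) →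
      (∀ x, x ∉ D → x ∈ boundary ends (hClass ends a D h) → a x = 0) →
      0 ≤ kform (clusterInEvent ends s {T : Set V | h ∈ T}) (clusterInEvent ends s 𝓤)
        (clusterInEvent ends s 𝓥) D a) :
    let Q := clusterInEvent ends s {T : Set V | h ∈ T}
    let U := clusterInEvent ends s 𝓤
    let e := clusterInEvent ends s 𝓥
    prob p (Q ∩ U) * prob p e + prob p U * prob p (Q ∩ e) ≤
      prob p (Q ∩ U ∩ e) + prob p Q * prob p (U ∩ e) := by
  intro Q U e
  have hk := tform_nonneg_of_star ends h Q U e hstar p hp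
  linarith [mul_comm (prob p U) (prob p (Q ∩ e))]

end Star

end TReduction

end Summit.Ventures.PercRepro2
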